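import Mathlib

/-!
# Hodge locus census — V3-XT, N = 1, 2 INERT: the conductor-3 half (discriminant `-9D`) of THEOREM I2 (engine A, abs-1 gen 26, ROW 6 addendum)

HONEST FRAMING: certified instances and evidence bearing on the general Hodge conjecture; no claim.

Companion of `Theorems/HodgeLocusCensusInert2At0.lean`.  For squarefree `D ≡ 3 (mod 8)`, `D > 3`, the classes of the order
`𝒪₃ = ℤ[3τ]`, `τ = (1+√-D)/2` (discriminant `-9D`, conductor 3 prime to `ℓ = 2`) embed optimally into the Hurwitz order `𝒪_H` by
`3τ ↦ y' = (3 + w')/2`, `w' = bi + cj + dk`, `b² + c² + d² = 9D`, `b, c, d` odd and not all divisible by 3; by the same mechanism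
(Gross–Zagier + Gross's `End_n(E_ω) = ℤ[ω] + 2ⁿ⁻¹𝒪_H`, [LauterViray2012, §2 p. 7, §7 pp. 14–18]) `v₂(j(C')) = 9 + 3N(C')` with the SAME
membership criterion (`criterion3_mod8` below: the constant `3` in place of `1` changes nothing), hence the dictionary

  (B')  `6·ν_{12+3k}(-9D) = r(9D; Q_k) - r(D; Q_k)`,  `r(n; Q_k) = #{(b,c,d) : b²+c²+d² = n, b ≡ c ≡ d (mod 2ᵏ⁺¹)}`

(the subtracted term removes the imprimitive vectors `3·(b₀,c₀,d₀)`), together with Gauss for the order, `r₃(9D) - r₃(D) = 24·h(-9D)`.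
CERTIFIED against the two-implementation census of `H_{-9D}` at 2 (precision 160, job j126586; histogram `{15: 98831, 18: 24727, 21: 6149,
24: 1542, 27: 379, 30: 122, 33: 19, 36: 5}`): for all 2023 squarefree `D ≡ 3 (mod 8)`, `11 ≤ D ≤ 20 000`: Gauss-for-the-order 2023/2023,
minimal slope 15 and slopes `≡ 0 (mod 3)` 2023/2023, (B') for `k = 1` (`= 6h(-9D)`), `2, 3, 4` each 2023/2023, and for `D ≤ 3000` the orbit
structure (2h(-9D) orbits of size 12 on the primitive vectors, exactly 3 vectors per meeting orbit at `k = 2`) — `conductor3.py`,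
`SUMMARY-I2-conductor3-20000.json`.  Consequence with (T) of the first file at `n = 9D ≡ 3 (mod 8)`:
`a(9D) - 2b(9D) = 4(h(-D) + h(-9D)) - 16(ν₁₈(-D) + ν₁₈(-9D))` (`I2c_conductor3`; a consistency statement — `E_{9D} ≅ E_D`).
Checked here: the criterion [omega], the anchors `D = 11` (`h(-99) = 2`, `ν₁₈(-99) = 1`) and `D = 19` (`h(-171) = 4`, `ν₁₈(-171) = 1`) [decide],
the order class-number numerals `h(-9D) = h(-D)(3 - (-D|3))` at the anchors, and the linear assembly [omega].  Cited results and the census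
range are NOT re-proved; tags: [cited] via [LauterViray2012]; [finite-check] conductor3.py; [decide]; [omega]; [numerals].
-/

namespace Summit.HodgeConjecture.HodgeConjecture.HodgeLocus.Census.Inert2At0Conductor3

/-- Membership criterion for the conductor-3 embeddings: with `2y' = (3, b, c, d)`, `b, c, d` odd,
`y' ∈ ℤ[ω] + 4𝒪_H ⇔ b ≡ c ≡ d (mod 8)` — identical to `Inert2At0.criterion_mod8`. [omega] -/
theorem criterion3_mod8 (b c d : ℤ) (hb : b % 2 = 1) (hc : c % 2 = 1) (hd : d % 2 = 1) :
    (∃ α β e₀ e₁ e₂ e₃ : ℤ, (e₀ - e₁) % 2 = 0 ∧ (e₁ - e₂) % 2 = 0 ∧ (e₂ - e₃) % 2 = 0 ∧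
        3 - 2 * α + β = 4 * e₀ ∧ b - β = 4 * e₁ ∧ c - β = 4 * e₂ ∧ d - β = 4 * e₃) ↔
      ((b - c) % 8 = 0 ∧ (c - d) % 8 = 0) := by
  constructor
  · rintro ⟨α, β, e₀, e₁, e₂, e₃, h₀, h₁, h₂, h₃, h₄, h₅, h₆⟩
    omega
  · rintro ⟨h₁, h₂⟩
    exact ⟨(3 + b) / 2, b, 0, 0, (c - b) / 4, (d - b) / 4, by omega, by omega, by omega, by omega, by omega, by omega, by omega⟩

/-- The general-level version: `y' ∈ ℤ[ω] + 2ᵏ𝒪_H ⇔ b ≡ c ≡ d (mod 2ᵏ⁺¹)`, instance `k = 3` (mod 16). [omega] -/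
theorem criterion3_mod16 (b c d : ℤ) (hb : b % 2 = 1) (hc : c % 2 = 1) (hd : d % 2 = 1) :
    (∃ α β e₀ e₁ e₂ e₃ : ℤ, (e₀ - e₁) % 2 = 0 ∧ (e₁ - e₂) % 2 = 0 ∧ (e₂ - e₃) % 2 = 0 ∧
        3 - 2 * α + β = 8 * e₀ ∧ b - β = 8 * e₁ ∧ c - β = 8 * e₂ ∧ d - β = 8 * e₃) ↔
      ((b - c) % 16 = 0 ∧ (c - d) % 16 = 0) := by
  constructor
  · rintro ⟨α, β, e₀, e₁, e₂, e₃, h₀, h₁, h₂, h₃, h₄, h₅, h₆⟩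
    omega
  · rintro ⟨h₁, h₂⟩
    exact ⟨(3 + b) / 2, b, 0, 0, (c - b) / 8, (d - b) / 8, by omega, by omega, by omega, by omega, by omega, by omega, by omega⟩

/-- A vector `3·(b₀, c₀, d₀)` satisfies the congruence mod `2ᵏ⁺¹` iff `(b₀, c₀, d₀)` does (3 is invertible mod powers of 2): the imprimitive
vectors of norm `9D` in `Q_k` are exactly `3·{vectors of norm D in Q_k}`, whence the subtraction `r(9D; Q_k) - r(D; Q_k)`. Instances mod 8, 16. [omega] -/
theorem imprimitive_congruence (b c d : ℤ) :
    (((3 * b - 3 * c) % 8 = 0 ∧ (3 * c - 3 * d) % 8 = 0) ↔ ((b - c) % 8 = 0 ∧ (c - d) % 8 = 0)) ∧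
    (((3 * b - 3 * c) % 16 = 0 ∧ (3 * c - 3 * d) % 16 = 0) ↔ ((b - c) % 16 = 0 ∧ (c - d) % 16 = 0)) := by
  constructor <;> omega

/-- Order class numbers at the anchors: `h(-9D) = h(-D)·(3 - (-D|3))` gives `h(-99) = 1·(3 - 1) = 2` (`-11 ≡ 1 (mod 3)`) and
`h(-171) = 1·(3 + 1) = 4` (`-19 ≡ 2 (mod 3)`). [numerals] -/
theorem order_classnumber_numerals :
    (-11 : ℤ) % 3 = 1 ∧ (1 : ℤ) * (3 - 1) = 2 ∧ (-19 : ℤ) % 3 = 2 ∧ (1 : ℤ) * (3 - (-1)) = 4 := by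
  refine ⟨by decide, by norm_num, by decide, by norm_num⟩

/-- Gauss for the order at `D = 11`: `r₃(99) = r₃(11) + 24·h(-99) = 24 + 48` (complete boxes). [decide] -/
theorem gauss_order_anchor_11 :
    ((Finset.Icc (-9 : ℤ) 9 ×ˢ Finset.Icc (-9 : ℤ) 9 ×ˢ Finset.Icc (-9 : ℤ) 9).filter
        (fun p => p.1 ^ 2 + p.2.1 ^ 2 + p.2.2 ^ 2 = (99 : ℤ))).card =
    ((Finset.Icc (-3 : ℤ) 3 ×ˢ Finset.Icc (-3 : ℤ) 3 ×ˢ Finset.Icc (-3 : ℤ) 3).filter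
        (fun p => p.1 ^ 2 + p.2.1 ^ 2 + p.2.2 ^ 2 = (11 : ℤ))).card + 24 * 2 := by
  decide +kernel

/-- Dictionary (B') anchors at `k = 2`, in the parametrisation `(b,c,d) = (t, t+8u, t+8v)`: `r(99; Q₂) - r(11; Q₂) = 6 - 0 = 6·ν₁₈(-99)`
and `r(171; Q₂) - r(19; Q₂) = 6 - 0 = 6·ν₁₈(-171)` (census: `ν₁₈(-99) = ν₁₈(-171) = 1`). [decide] -/
theorem dictionary3_anchors :
    ((Finset.Icc (-9 : ℤ) 9 ×ˢ Finset.Icc (-3 : ℤ) 3 ×ˢ Finset.Icc (-3 : ℤ) 3).filter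
        (fun p => p.1 ^ 2 + (p.1 + 8 * p.2.1) ^ 2 + (p.1 + 8 * p.2.2) ^ 2 = (99 : ℤ))).card = 6 * 1 ∧
    ((Finset.Icc (-3 : ℤ) 3 ×ˢ Finset.Icc (-1 : ℤ) 1 ×ˢ Finset.Icc (-1 : ℤ) 1).filter
        (fun p => p.1 ^ 2 + (p.1 + 8 * p.2.1) ^ 2 + (p.1 + 8 * p.2.2) ^ 2 = (11 : ℤ))).card = 0 ∧
    ((Finset.Icc (-13 : ℤ) 13 ×ˢ Finset.Icc (-4 : ℤ) 4 ×ˢ Finset.Icc (-4 : ℤ) 4).filter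
        (fun p => p.1 ^ 2 + (p.1 + 8 * p.2.1) ^ 2 + (p.1 + 8 * p.2.2) ^ 2 = (171 : ℤ))).card = 6 * 1 ∧
    ((Finset.Icc (-4 : ℤ) 4 ×ˢ Finset.Icc (-1 : ℤ) 1 ×ˢ Finset.Icc (-1 : ℤ) 1).filter
        (fun p => p.1 ^ 2 + (p.1 + 8 * p.2.1) ^ 2 + (p.1 + 8 * p.2.2) ^ 2 = (19 : ℤ))).card = 0 := by
  refine ⟨by decide +kernel, by decide +kernel, by decide +kernel, by decide +kernel⟩

/-- Assembly: (T) at `n = 9D`, Gauss for `𝒪_K` and for `𝒪₃`, and the dictionaries (B) (k = 2) for `-D` and (B') for `-9D` give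
`a(9D) - 2b(9D) = 4(h(-D) + h(-9D)) - 16(ν₁₈(-D) + ν₁₈(-9D))`. [omega] -/
theorem I2c_conductor3 (a₉ b₉ r₃D r₃D9 rQD rQD9 h h₉ ν ν₉ : ℤ)
    (hT : 6 * a₉ - 12 * b₉ = r₃D9 - 16 * rQD9) (hGauss : r₃D = 24 * h) (hGauss₉ : r₃D9 - r₃D = 24 * h₉)
    (hDict : rQD = 6 * ν) (hDict₉ : rQD9 - rQD = 6 * ν₉) :
    a₉ - 2 * b₉ = 4 * (h + h₉) - 16 * (ν + ν₉) := by
  omega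

/-- Anchor instance `D = 11`: `h = 1, h₉ = 2, ν = 0, ν₉ = 1` gives `a(99) - 2b(99) = 12 - 16 = -4`; directly (complete boxes)
`a(99) = #{x²+2y²+8z² = 99}`, `b(99) = #{x²+2y²+32z² = 99}`. [decide] -/
theorem anchor_99 :
    (((Finset.Icc (-9 : ℤ) 9 ×ˢ Finset.Icc (-7 : ℤ) 7 ×ˢ Finset.Icc (-3 : ℤ) 3).filter
        (fun p => p.1 ^ 2 + 2 * p.2.1 ^ 2 + 8 * p.2.2 ^ 2 = (99 : ℤ))).card : ℤ) -
      2 * ((Finset.Icc (-9 : ℤ) 9 ×ˢ Finset.Icc (-7 : ℤ) 7 ×ˢ Finset.Icc (-1 : ℤ) 1).filter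
        (fun p => p.1 ^ 2 + 2 * p.2.1 ^ 2 + 32 * p.2.2 ^ 2 = (99 : ℤ))).card = 4 * (1 + 2) - 16 * (0 + 1) := by
  decide +kernel

end Summit.HodgeConjecture.HodgeConjecture.HodgeLocus.Census.Inert2At0Conductor3
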